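import Summits.AtomisticToContinuum.FouriersLaw.Theorems.OddSectorIrreversibilityTapLeakBoundFloorBudgetTail
import Summits.AtomisticToContinuum.FouriersLaw.Theorems.OddSectorIrreversibilityTapLeakBoundFloorBudget

/-!
# `TapLeakBound` (stmt-AtomisticToContinuum-15159), line `SketchIdeator2`, floor of `stub_kickCone`: the SUP-IN-TIME maximal inequality

Helper file (`--supports stmt-AtomisticToContinuum-15159`) for crux
P = `Summit.AtomisticToContinuum.FouriersLaw.Theses.OddSectorIrreversibility.TapLeakBound`, registered stub `stub_kickCone`
(C′ `ResampledKickCone`), sub-stub `stub_floorSupTail` of the second floor program (lead c3, session 3): the `N`-UNIFORM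
maximal inequality for the RUNNING MAXIMUM of a site energy along the closed flow of `pinnedChain ω₂ lam β 0`,

  `μ_T{x : ∃ τ ∈ [0,s], E < h_m(Φ_τ x)} ≤ (2/E)^k ∫ h_m^k dμ_T + (2/E)^{n+1} · s · ∫ h_m^n (|j_{m-1}| + |j_m|) dμ_T`

for every `k, n`, every `s ≥ 0`, `E > 0`, every `N` and every site `m` (`h_m` the site energy, `j_{m-1}, j_m` its adjacent
currents, `μ_T` the unnormalised Gibbs weight). Compared with the landed budget inequality (`…FloorBudgetTail`: the event
`E < h_m + ∫_{(0,s]}(|j_{m-1}|+|j_m|)∘Φ`, whose time integral has mean `≍ s` and forces the cap `E ≳ s`), the window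
length `s` enters here only as a PREFACTOR: the cap `E` may be taken as small as the Gibbs tails allow. Mechanism (the
"climb lemma", `half_le_of_climb`): if `h_m(x) ≤ E/2` but `h_m(Φ_{t₁} x) > E`, then between the LAST time `t₀ ≤ t₁` with
`h_m(Φ_{t₀}x) ≤ E/2` and `t₁` the energy balance `h_m(Φ_{t₁}x) − h_m(Φ_{t₀}x) ≤ ∫_{t₀}^{t₁}(|j_{m-1}|+|j_m|)∘Φ` runs
entirely above level `E/2`, where `1 ≤ (2h_m/E)^n`; hence `E/2 ≤ (2/E)^n ∫_0^s (h_m^n(|j_{m-1}|+|j_m|))∘Φ_t dt`, an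
observable whose `μ_T`-mean is `s ∫ h_m^n(|j_{m-1}|+|j_m|) dμ_T` by Tonelli and Liouville. Markov finishes. Also here: the
flag form of the sup event (`supFlag`-free: an indicator), so that the landed good-set bookkeeping of `…FloorBudget`
(`measurableSet_goodSet`, `goodSet_resample_iff`, `prod_compl_goodSet_le`) applies verbatim to sup-caps.
References: folklore (maximal inequality by last-exit decomposition; Liouville). Nothing here closes the item.
-/

noncomputable section

open MeasureTheory ProbabilityTheory Filter Topology Set Function
open scoped NNReal ENNReal

namespace Summit.AtomisticToContinuum.FouriersLaw.Theorems.OddSectorIrreversibility.TapLeak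

open Literature.MathematicalPhysics.KineticTheory.HeatConduction
open Literature.MathematicalPhysics.KineticTheory
open Summit.AtomisticToContinuum.FouriersLaw.Theorems.ClosedConeSensitivity.Negative.ZeroFrictionDictionary
open Summit.AtomisticToContinuum.FouriersLaw.Theorems.OddSectorIrreversibility.Corrector
open Summit.AtomisticToContinuum.FouriersLaw.Theorems.OddSectorWitness
open Summit.AtomisticToContinuum.FouriersLaw.Theorems.SubBallisticWindow.CoboundaryCeiling

/-! ### §1 The climb lemma (pure real analysis) -/

section Climb

/-- **Climb lemma.** Let `φ, w : ℝ → ℝ` be continuous, `φ, w ≥ 0`, with the one-sided balance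
`φ(t₁) ≤ φ(t₀) + ∫_{(t₀,t₁]} w` for `0 ≤ t₀ ≤ t₁ ≤ s`. If `φ(0) ≤ E/2` and `φ(t₁) > E` for some `t₁ ∈ [0,s]`, then
`E/2 ≤ (2/E)^n ∫_{(0,s]} φ^n w` for every `n` (last exit from `{φ ≤ E/2}` before `t₁`, then the balance above level
`E/2`, where `1 ≤ (2φ/E)^n`). [folklore] -/
theorem half_le_of_climb {φ w : ℝ → ℝ} (hφ : Continuous φ) (hw : Continuous w) (hw0 : ∀ t, 0 ≤ w t)
    (hφ0 : ∀ t, 0 ≤ φ t) {s E : ℝ} (hE : 0 < E)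
    (hbal : ∀ t₀ t₁, 0 ≤ t₀ → t₀ ≤ t₁ → t₁ ≤ s → φ t₁ ≤ φ t₀ + ∫ t in Ioc t₀ t₁, w t)
    (h0 : φ 0 ≤ E / 2) {t₁ : ℝ} (ht₁ : t₁ ∈ Icc (0 : ℝ) s) (hE1 : E < φ t₁) (n : ℕ) :
    E / 2 ≤ (2 / E) ^ n * ∫ t in Ioc (0 : ℝ) s, φ t ^ n * w t := by
  -- the last exit from `{φ ≤ E/2}` before `t₁`
  set S : Set ℝ := Icc (0 : ℝ) t₁ ∩ φ ⁻¹' Iic (E / 2) with hS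
  have hSc : IsClosed S := isClosed_Icc.inter (isClosed_Iic.preimage hφ)
  have h0S : (0 : ℝ) ∈ S := ⟨⟨le_rfl, ht₁.1⟩, h0⟩
  have hSne : S.Nonempty := ⟨0, h0S⟩
  have hSbdd : BddAbove S := ⟨t₁, fun t ht => ht.1.2⟩
  set t₀ : ℝ := sSup S with ht₀
  have ht₀S : t₀ ∈ S := hSc.csSup_mem hSne hSbdd
  have ht₀0 : 0 ≤ t₀ := ht₀S.1.1
  have ht₀1 : t₀ ≤ t₁ := ht₀S.1.2
  have hφt₀ : φ t₀ ≤ E / 2 := ht₀S.2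
  have habove : ∀ t ∈ Ioc t₀ t₁, E / 2 < φ t := by
    intro t ht
    by_contra hle
    push Not at hle
    have htS : t ∈ S := ⟨⟨ht₀0.trans ht.1.le, ht.2⟩, hle⟩
    have := le_csSup hSbdd htS
    linarith [ht.1]
  -- the balance on `(t₀, t₁]`
  have h1 : E / 2 < ∫ t in Ioc t₀ t₁, w t := by
    have := hbal t₀ t₁ ht₀0 ht₀1 ht₁.2
    linarith
  -- insert the weight `(2φ/E)^n ≥ 1`
  have hwt : ∀ t ∈ Ioc t₀ t₁, w t ≤ (2 / E) ^ n * (φ t ^ n * w t) := by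
    intro t ht
    have h2 : 1 ≤ 2 / E * φ t := by
      rw [div_mul_eq_mul_div, le_div_iff₀ hE]; linarith [habove t ht]
    have h3 : 1 ≤ (2 / E) ^ n * φ t ^ n := by
      rw [← mul_pow]; exact one_le_pow₀ h2
    calc w t = 1 * w t := (one_mul _).symm
      _ ≤ ((2 / E) ^ n * φ t ^ n) * w t := mul_le_mul_of_nonneg_right h3 (hw0 t)
      _ = (2 / E) ^ n * (φ t ^ n * w t) := by ring
  have hFc : Continuous fun t => φ t ^ n * w t := (hφ.pow n).mul hw
  have hF0 : ∀ t, 0 ≤ φ t ^ n * w t := fun t => mul_nonneg (pow_nonneg (hφ0 t) n) (hw0 t)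
  have h2 : ∫ t in Ioc t₀ t₁, w t ≤ ∫ t in Ioc t₀ t₁, (2 / E) ^ n * (φ t ^ n * w t) :=
    setIntegral_mono_on hw.integrableOn_Ioc (hFc.const_mul _).integrableOn_Ioc measurableSet_Ioc hwt
  have h3 : ∫ t in Ioc t₀ t₁, φ t ^ n * w t ≤ ∫ t in Ioc (0 : ℝ) s, φ t ^ n * w t :=
    setIntegral_mono_set hFc.integrableOn_Ioc (Eventually.of_forall hF0)
      (Eventually.of_forall (Ioc_subset_Ioc ht₀0 ht₁.2))
  rw [integral_const_mul] at h2
  have h4 : (2 / E) ^ n * ∫ t in Ioc t₀ t₁, φ t ^ n * w t ≤ (2 / E) ^ n * ∫ t in Ioc (0 : ℝ) s, φ t ^ n * w t :=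
    mul_le_mul_of_nonneg_left h3 (pow_nonneg (by positivity) n)
  linarith

end Climb

/-! ### §2 The energy balance between two times along the closed flow -/

variable {N : ℕ}

section Pinned

variable {ω₂ lam β : ℝ} (hω : 0 < ω₂) (hl : 0 ≤ lam) (hβ : 0 ≤ β)
include hω hl hβ

/-- **Energy balance between two times.** For every site `m` and `0 ≤ t₀ ≤ t₁`:
`h_m(Φ_{t₁} x) ≤ h_m(Φ_{t₀} x) + ∫_{(t₀,t₁]} (|Σ_k[k+1=m] j_k| + |j_m|)(Φ_t x) dt` (the landed balance from time `0`
at the point `Φ_{t₀} x`, the flow property `Φ_{t₀+t} = Φ_t ∘ Φ_{t₀}` and a time shift). [folklore] -/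
theorem siteEnergy_detFlow_le_detFlow_add_setIntegral (m : Fin N) (X : PhaseSpace N → ℝ)
    (hX : X = fun x => (∑ k : Fin N, (if k = m then (1 : ℝ) else 0) * (x.2 k ^ 2 / 2 + (pinnedChain ω₂ lam β 0).U (x.1 k))) +
      ∑ k : Fin N, ∑ l : Fin N,
        if l.val = k.val + 1 then ((if k = m then (1 : ℝ) else 0) + (if l = m then (1 : ℝ) else 0)) / 2 *
          (pinnedChain ω₂ lam β 0).V (x.1 l - x.1 k) else 0)
    (x : PhaseSpace N) {t₀ t₁ : ℝ} (ht₀ : 0 ≤ t₀) (h01 : t₀ ≤ t₁) :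
    X (detFlow ω₂ lam β N t₁ x) ≤ X (detFlow ω₂ lam β N t₀ x) + ∫ t in Ioc t₀ t₁,
      (|∑ k : Fin N, (if k.val + 1 = m.val then (pinnedChain ω₂ lam β 0).bondCurrent N k (detFlow ω₂ lam β N t x) else 0)| +
        |(pinnedChain ω₂ lam β 0).bondCurrent N m (detFlow ω₂ lam β N t x)|) := by
  set P0 := pinnedChain ω₂ lam β 0 with hP0
  set F : PhaseSpace N → ℝ := fun z =>
    |∑ k : Fin N, (if k.val + 1 = m.val then P0.bondCurrent N k z else 0)| + |P0.bondCurrent N m z| with hF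
  set y : PhaseSpace N := detFlow ω₂ lam β N t₀ x with hy
  have hd : 0 ≤ t₁ - t₀ := sub_nonneg.2 h01
  have h := siteEnergy_detFlow_le_budget hω hl hβ m X hX y (s := t₁ - t₀) (τ := t₁ - t₀) hd le_rfl
  -- the flow property
  have hflow : ∀ {t : ℝ}, 0 ≤ t → detFlow ω₂ lam β N t y = detFlow ω₂ lam β N (t₀ + t) x := fun {t} ht => by
    rw [hy, ← detFlow_add hω hl hβ N x ht₀ ht]
  have h1 : detFlow ω₂ lam β N (t₁ - t₀) y = detFlow ω₂ lam β N t₁ x := by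
    rw [hflow hd, add_sub_cancel]
  -- the time shift in the window integral
  have h2 : ∫ t in Ioc (0 : ℝ) (t₁ - t₀), F (detFlow ω₂ lam β N t y) = ∫ t in Ioc t₀ t₁, F (detFlow ω₂ lam β N t x) := by
    have e1 : ∫ t in Ioc (0 : ℝ) (t₁ - t₀), F (detFlow ω₂ lam β N t y) =
        ∫ t in Ioc (0 : ℝ) (t₁ - t₀), F (detFlow ω₂ lam β N (t₀ + t) x) :=
      setIntegral_congr_fun measurableSet_Ioc fun t ht => by rw [hflow ht.1.le]
    rw [e1, ← intervalIntegral.integral_of_le hd, ← intervalIntegral.integral_of_le h01,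
      intervalIntegral.integral_comp_add_left (fun t => F (detFlow ω₂ lam β N t x)) t₀, add_zero, add_sub_cancel]
  have h3 : X (detFlow ω₂ lam β N (t₁ - t₀) y) ≤ X y + ∫ t in Ioc (0 : ℝ) (t₁ - t₀), F (detFlow ω₂ lam β N t y) := h
  rw [h1, h2] at h3
  exact h3

/-! ### §3 The sup-in-time maximal inequality -/

/-- **THE SUP-IN-TIME MAXIMAL INEQUALITY, uniformly in `N`.** For every site `m`, all `k, n`, `s ≥ 0`, `E > 0`
(with `h_m^k` and `h_m^n(|j_{m-1}|+|j_m|)` in `L¹(μ_T)`):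
`μ_T{x : ∃ τ ∈ [0,s], E < h_m(Φ_τ x)} ≤ (2/E)^k ∫ h_m^k dμ_T + (2/E)^{n+1} s ∫ h_m^n(|j_{m-1}|+|j_m|) dμ_T`
(climb lemma pointwise; Markov; Tonelli and Liouville for the time integral). [folklore] -/
theorem measureReal_sup_gt_le_pow (γ : ℝ) {T : ℝ} (hT : 0 < T) (m : Fin N) (X : PhaseSpace N → ℝ)
    (hX : X = fun x => (∑ k : Fin N, (if k = m then (1 : ℝ) else 0) * (x.2 k ^ 2 / 2 + (pinnedChain ω₂ lam β 0).U (x.1 k))) +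
      ∑ k : Fin N, ∑ l : Fin N,
        if l.val = k.val + 1 then ((if k = m then (1 : ℝ) else 0) + (if l = m then (1 : ℝ) else 0)) / 2 *
          (pinnedChain ω₂ lam β 0).V (x.1 l - x.1 k) else 0)
    {k n : ℕ} (hXk : Integrable (fun x => X x ^ k) (gibbsWeight ω₂ lam β γ N T))
    (hW : Integrable (fun x => X x ^ n *
      (|∑ k : Fin N, (if k.val + 1 = m.val then (pinnedChain ω₂ lam β 0).bondCurrent N k x else 0)| +
        |(pinnedChain ω₂ lam β 0).bondCurrent N m x|)) (gibbsWeight ω₂ lam β γ N T))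
    {s E : ℝ} (hs : 0 ≤ s) (hE : 0 < E) :
    (gibbsWeight ω₂ lam β γ N T).real {x | ∃ τ ∈ Icc (0 : ℝ) s, E < X (detFlow ω₂ lam β N τ x)} ≤
      (2 / E) ^ k * ∫ x, X x ^ k ∂(gibbsWeight ω₂ lam β γ N T) +
        (2 / E) ^ (n + 1) * s * ∫ x, X x ^ n *
          (|∑ k : Fin N, (if k.val + 1 = m.val then (pinnedChain ω₂ lam β 0).bondCurrent N k x else 0)| +
            |(pinnedChain ω₂ lam β 0).bondCurrent N m x|) ∂(gibbsWeight ω₂ lam β γ N T) := by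
  set μ := gibbsWeight ω₂ lam β γ N T with hμ
  haveI : IsFiniteMeasure μ := isFiniteMeasure_gibbsWeight hω hl hβ γ N hT
  set P0 := pinnedChain ω₂ lam β 0 with hP0
  set jj : PhaseSpace N → ℝ := fun z =>
    |∑ k : Fin N, (if k.val + 1 = m.val then P0.bondCurrent N k z else 0)| + |P0.bondCurrent N m z| with hjj
  set W : PhaseSpace N → ℝ := fun z => X z ^ n * jj z with hW'
  -- regularity
  have hU0 : ∀ q, 0 ≤ P0.U q := fun q => by
    show 0 ≤ ω₂ * q ^ 2 / 2 + lam * q ^ 4 / 4; positivity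
  have hV0 : ∀ r, 0 ≤ P0.V r := fun r => by
    show 0 ≤ r ^ 2 / 2 + β * r ^ 4 / 4; positivity
  have hX0 : ∀ x, 0 ≤ X x := fun x => siteEnergy_nonneg P0 m X hX hU0 hV0 x
  have hXc : Continuous X := (contDiff_siteEnergy m X hX).continuous
  have hjjc : Continuous jj :=
    (continuous_leftCurrent ω₂ lam β 0 N m).abs.add (pinnedChain_continuous_bondCurrent ω₂ lam β 0 N m).abs
  have hjj0 : ∀ z, 0 ≤ jj z := fun z => add_nonneg (abs_nonneg _) (abs_nonneg _)
  have hWc : Continuous W := (hXc.pow n).mul hjjc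
  have hW0 : ∀ z, 0 ≤ W z := fun z => mul_nonneg (pow_nonneg (hX0 z) n) (hjj0 z)
  -- the transported observable and its mean (Tonelli + Liouville)
  set I : PhaseSpace N → ℝ := fun x => ∫ t in Ioc (0 : ℝ) s, W (detFlow ω₂ lam β N t x) with hI
  have hI0 : ∀ x, 0 ≤ I x := fun x => setIntegral_nonneg measurableSet_Ioc fun t _ => hW0 _
  obtain ⟨hIi, hI_eq⟩ : Integrable I μ ∧ ∫ x, I x ∂μ = s * ∫ x, W x ∂μ :=
    integral_setIntegral_comp_detFlow hω hl hβ γ N hT hs hWc hW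
  -- pointwise inclusion by the climb lemma
  have hE2 : 0 < E / 2 := by positivity
  have hsub : {x | ∃ τ ∈ Icc (0 : ℝ) s, E < X (detFlow ω₂ lam β N τ x)} ⊆
      {x | (E / 2) ^ k ≤ X x ^ k} ∪ {x | E / 2 ≤ (2 / E) ^ n * I x} := by
    rintro x ⟨τ, hτ, hEτ⟩
    simp only [mem_setOf_eq, mem_union]
    by_cases hx : E / 2 ≤ X x
    · exact Or.inl (pow_le_pow_left₀ hE2.le hx k)
    · right
      push Not at hx
      have hΦc : Continuous fun t => detFlow ω₂ lam β N t x := Corrector.continuous_detFlow_time hω hl hβ N x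
      have hφ : Continuous fun t => X (detFlow ω₂ lam β N t x) := hXc.comp hΦc
      have hw : Continuous fun t => jj (detFlow ω₂ lam β N t x) := hjjc.comp hΦc
      have h0 : X (detFlow ω₂ lam β N 0 x) ≤ E / 2 := by
        rw [detFlow_of_nonpos N le_rfl x]; exact hx.le
      have hbal : ∀ t₀ t₁, 0 ≤ t₀ → t₀ ≤ t₁ → t₁ ≤ s →
          X (detFlow ω₂ lam β N t₁ x) ≤ X (detFlow ω₂ lam β N t₀ x) +
            ∫ t in Ioc t₀ t₁, jj (detFlow ω₂ lam β N t x) := fun t₀ t₁ h₀ h₁ _ =>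
        siteEnergy_detFlow_le_detFlow_add_setIntegral hω hl hβ m X hX x h₀ h₁
      exact half_le_of_climb hφ hw (fun t => hjj0 _) (fun t => hX0 _) hE hbal h0 hτ hEτ n
  -- Markov, twice
  have hM1 : (E / 2) ^ k * μ.real {x | (E / 2) ^ k ≤ X x ^ k} ≤ ∫ x, X x ^ k ∂μ :=
    mul_meas_ge_le_integral_of_nonneg (Eventually.of_forall fun x => pow_nonneg (hX0 x) k) hXk _
  have hM2 : (E / 2) * μ.real {x | E / 2 ≤ (2 / E) ^ n * I x} ≤ ∫ x, (2 / E) ^ n * I x ∂μ :=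
    mul_meas_ge_le_integral_of_nonneg
      (Eventually.of_forall fun x => mul_nonneg (pow_nonneg (by positivity) n) (hI0 x)) (hIi.const_mul _) _
  have h22 : (2 / E) * (E / 2) = 1 := by
    rw [div_mul_div_comm, mul_comm (2 : ℝ) E]; exact div_self (by positivity)
  have hunit : (2 / E) ^ k * (E / 2) ^ k = 1 := by rw [← mul_pow, h22, one_pow]
  have h2E : (0 : ℝ) ≤ 2 / E := by positivity
  have hA : μ.real {x | (E / 2) ^ k ≤ X x ^ k} ≤ (2 / E) ^ k * ∫ x, X x ^ k ∂μ :=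
    calc μ.real {x | (E / 2) ^ k ≤ X x ^ k}
          = (2 / E) ^ k * ((E / 2) ^ k * μ.real {x | (E / 2) ^ k ≤ X x ^ k}) := by
          rw [← mul_assoc, hunit, one_mul]
      _ ≤ (2 / E) ^ k * ∫ x, X x ^ k ∂μ := mul_le_mul_of_nonneg_left hM1 (pow_nonneg h2E k)
  have hB : μ.real {x | E / 2 ≤ (2 / E) ^ n * I x} ≤ (2 / E) ^ (n + 1) * s * ∫ x, W x ∂μ :=
    calc μ.real {x | E / 2 ≤ (2 / E) ^ n * I x}
          = (2 / E) * ((E / 2) * μ.real {x | E / 2 ≤ (2 / E) ^ n * I x}) := by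
          rw [← mul_assoc, h22, one_mul]
      _ ≤ (2 / E) * ∫ x, (2 / E) ^ n * I x ∂μ := mul_le_mul_of_nonneg_left hM2 h2E
      _ = (2 / E) ^ (n + 1) * s * ∫ x, W x ∂μ := by
          rw [integral_const_mul, hI_eq, pow_succ]; ring
  calc μ.real {x | ∃ τ ∈ Icc (0 : ℝ) s, E < X (detFlow ω₂ lam β N τ x)}
        ≤ μ.real ({x | (E / 2) ^ k ≤ X x ^ k} ∪ {x | E / 2 ≤ (2 / E) ^ n * I x}) :=
        measureReal_mono hsub (measure_ne_top μ _)
    _ ≤ μ.real {x | (E / 2) ^ k ≤ X x ^ k} + μ.real {x | E / 2 ≤ (2 / E) ^ n * I x} :=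
        measureReal_union_le _ _
    _ ≤ _ := add_le_add hA hB

/-! ### §4 The sup event as a flag budget (so that the landed good-set bookkeeping applies verbatim) -/

/-- **The sup-good event is closed**: `{x : ∀ τ ∈ [0,s], h_m(Φ_τ x) ≤ E}` is an intersection of closed sets
(continuity of `x ↦ Φ_τ x` at each fixed `τ`). [folklore] -/
theorem isClosed_supGood (m : Fin N) (X : PhaseSpace N → ℝ)
    (hX : X = fun x => (∑ k : Fin N, (if k = m then (1 : ℝ) else 0) * (x.2 k ^ 2 / 2 + (pinnedChain ω₂ lam β 0).U (x.1 k))) +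
      ∑ k : Fin N, ∑ l : Fin N,
        if l.val = k.val + 1 then ((if k = m then (1 : ℝ) else 0) + (if l = m then (1 : ℝ) else 0)) / 2 *
          (pinnedChain ω₂ lam β 0).V (x.1 l - x.1 k) else 0)
    (s E : ℝ) :
    IsClosed {x : PhaseSpace N | ∀ τ ∈ Icc (0 : ℝ) s, X (detFlow ω₂ lam β N τ x) ≤ E} := by
  have hXc : Continuous X := (contDiff_siteEnergy m X hX).continuous
  have e : {x : PhaseSpace N | ∀ τ ∈ Icc (0 : ℝ) s, X (detFlow ω₂ lam β N τ x) ≤ E} =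
      ⋂ τ ∈ Icc (0 : ℝ) s, {x | X (detFlow ω₂ lam β N τ x) ≤ E} := by
    ext x; simp
  rw [e]
  exact isClosed_biInter fun τ _ => isClosed_le (hXc.comp (continuous_detFlow hω hl hβ N τ)) continuous_const

end Pinned

/-- **Flag of a set**: the indicator `E + 1` of the complement is `≤ E` exactly on the set (`E ≥ 0`). [folklore] -/
theorem indicator_compl_le_iff {α : Type*} (S : Set α) {E : ℝ} (hE : 0 ≤ E) (x : α) :
    Sᶜ.indicator (fun _ => E + 1) x ≤ E ↔ x ∈ S := by
  by_cases hx : x ∈ S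
  · simp [hx, hE]
  · simp [hx]

/-- **Flag of a set**: the indicator `E + 1` of the complement exceeds `E` exactly off the set (`E ≥ 0`). [folklore] -/
theorem lt_indicator_compl_iff {α : Type*} (S : Set α) {E : ℝ} (hE : 0 ≤ E) (x : α) :
    E < Sᶜ.indicator (fun _ => E + 1) x ↔ x ∉ S := by
  by_cases hx : x ∈ S
  · simp [hx, hE]
  · simp [hx]

/-- The bad set of the flag is the complement: `{x : E < flag_S(x)} = Sᶜ` (`E ≥ 0`). [folklore] -/
theorem setOf_lt_indicator_compl {α : Type*} (S : Set α) {E : ℝ} (hE : 0 ≤ E) :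
    {x | E < Sᶜ.indicator (fun _ => E + 1) x} = Sᶜ := by
  ext x; exact lt_indicator_compl_iff S hE x

/-- The complement of the sup-good event is the sup-bad event. [folklore] -/
theorem compl_setOf_forall_le_eq {α : Type*} (f : ℝ → α → ℝ) (s E : ℝ) :
    {x : α | ∀ τ ∈ Icc (0 : ℝ) s, f τ x ≤ E}ᶜ = {x | ∃ τ ∈ Icc (0 : ℝ) s, E < f τ x} := by
  ext x
  simp only [mem_compl_iff, mem_setOf_eq, not_forall, not_le, exists_prop]

/-! ### Registered sub-stub of the second floor program (closed form of `measureReal_sup_gt_le_pow`) -/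

/-- **Sub-goal `stub_floorSupTail`** (registered on the crux item for this helper file; closed `∀`-form of
`measureReal_sup_gt_le_pow`): the `N`-uniform sup-in-time maximal inequality for a site energy along the closed
flow — the window length enters only as a prefactor. [folklore] -/
theorem stub_floorSupTail : ∀ (ω₂ lam β : ℝ), 0 < ω₂ → 0 ≤ lam → 0 ≤ β → ∀ (γ : ℝ) (N : ℕ) (T : ℝ), 0 < T → ∀ (m : Fin N) (X : PhaseSpace N → ℝ), (X = fun x => (∑ k : Fin N, (if k = m then (1 : ℝ) else 0) * (x.2 k ^ 2 / 2 + (pinnedChain ω₂ lam β 0).U (x.1 k))) + ∑ k : Fin N, ∑ l : Fin N, if l.val = k.val + 1 then ((if k = m then (1 : ℝ) else 0) + (if l = m then (1 : ℝ) else 0)) / 2 * (pinnedChain ω₂ lam β 0).V (x.1 l - x.1 k) else 0) → ∀ (k n : ℕ), MeasureTheory.Integrable (fun x => X x ^ k) (gibbsWeight ω₂ lam β γ N T) → MeasureTheory.Integrable (fun x => X x ^ n * (|∑ k : Fin N, (if k.val + 1 = m.val then (pinnedChain ω₂ lam β 0).bondCurrent N k x else 0)| + |(pinnedChain ω₂ lam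 β 0).bondCurrent N m x|)) (gibbsWeight ω₂ lam β γ N T) → ∀ (s E : ℝ), 0 ≤ s → 0 < E → (gibbsWeight ω₂ lam β γ N T).real {x | ∃ τ ∈ Set.Icc (0 : ℝ) s, E < X (Summit.AtomisticToContinuum.FouriersLaw.Theorems.ClosedConeSensitivity.Negative.ZeroFrictionDictionary.detFlow ω₂ lam β N τ x)} ≤ (2 / E) ^ k * ∫ x, X x ^ k ∂(gibbsWeight ω₂ lam β γ N T) + (2 / E) ^ (n + 1) * s * ∫ x, X x ^ n * (|∑ k : Fin N, (if k.val + 1 = m.val then (pinnedChain ω₂ lam β 0).bondCurrent N k x else 0)| + |(pinnedChain ω₂ lam β 0).bondCurrent N m x|) ∂(gibbsWeight ω₂ lam β γ N T) :=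
  fun _ _ _ hω hl hβ γ _ _ hT m X hX _ _ hXk hW _ _ hs hE =>
    measureReal_sup_gt_le_pow hω hl hβ γ hT m X hX hXk hW hs hE

end Summit.AtomisticToContinuum.FouriersLaw.Theorems.OddSectorIrreversibility.TapLeak

end
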